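import Summits.Ventures.DiscreteObjects.PP12.OrderElevenHomologyKernel

/-!
# PP(12), order-11 cell, Case A: blocking SCAN of the orbit representatives, slices 4–7 (representatives 80–159) (designs g22)
Framing: lottery ticket; floor = certified bounds/negative ranges.

Cell pub-namedobj (venture DiscreteObjects), target (M), P11-SIZING.md. Each declaration: `Homology12.scanOK (20k) 20 = true` by `decide +kernel` — the representatives
`REPS[20k, 20k+20)` have no compatible row among the 3,441 rows `CANDS3` (68,820 compatibility tests, ≈ 60–80 s of kernel time each; at most four declarations per
file — ten in one file overran the farm's elaboration window in designs g22's test). No `sorry`, no axioms; nothing here asserts a census statement by itself.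
-/

namespace Summit.Ventures.DiscreteObjects.PP12

namespace Homology12

set_option maxHeartbeats 400000000 in
/-- representatives `80 … 99` are blocked by index `2` -/
theorem scan_04 : scanOK 80 20 = true := by decide +kernel

set_option maxHeartbeats 400000000 in
/-- representatives `100 … 119` are blocked by index `2` -/
theorem scan_05 : scanOK 100 20 = true := by decide +kernel

set_option maxHeartbeats 400000000 in
/-- representatives `120 … 139` are blocked by index `2` -/
theorem scan_06 : scanOK 120 20 = true := by decide +kernel

set_option maxHeartbeats 400000000 in
/-- representatives `140 … 159` are blocked by index `2` -/
theorem scan_07 : scanOK 140 20 = true := by decide +kernel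

end Homology12

end Summit.Ventures.DiscreteObjects.PP12
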